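/-
Copyright (c) 2026. All rights reserved.
Released under Apache 2.0 license as described in the file LICENSE.
Authors: abc-iut cell, prover seat abc-iut-f-102 (F fact-proving wave, gen 3).
-/
import Literature.AnabelianGeometry.AbsoluteAnabelian.LogFrobeniusRealisesGenerators
import Literature.AnabelianGeometry.AbsoluteAnabelian.LogFrobeniusHolomorphicOverData
import HarnessLib

/-!
# [AbsTopIII] Cor 5.5 (iii)/(i): the core homotopy over `ℰ•` on the whiskered `ι⊞`-generators (THEOREM B, toolkit 3/4)

S. Mochizuki, *Topics in absolute anabelian geometry III: global reconstruction algorithms*,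
J. Math. Sci. Univ. Tokyo 22 (2015) 939–1156 [MochizukiAbsTopIII2015]; locators `p.N` = pages of the author's
manuscript (`paper:url-5493eb38cbb7`), read on the page: Def 5.4 (iv) pp. 126–127 ("`λ⊞_{v,ν}` lies over `Th•[Z]`"),
(vii) p. 128 (the `ι⊞_{v,ε}`), Cor 5.5 (i) p. 130 (the core `ℰ•`), (iii) p. 131 (the observables `S_log⊞`), Def 3.5 (ii)
p. 75 (families of homotopies: whiskering).

THE KEY COMPUTATION of THEOREM B (f-102 lineage; toolkit 1/4 `LogFrobeniusRealisesGenerators`, 2/4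
`LogFrobeniusHolomorphicOverData`).  Inside ONE family of homotopies on `D•⊢` the observable pair
`([λ⊞_{ν₁}], [λ⊞_{ν₂}])` (homotopy `ι⊞_{v,ε}`) post-composed with `𝒩⊞_v → 𝒩_v → ℰ•` must carry BOTH the whiskered homotopy
`ι⊞_{v,ε} ▷ (𝒩⊞_v → ℰ•)` (Def 3.5 (ii), third axiom) AND the core homotopy of `ℰ•` (Cor 5.5 (i)).  For the core homotopies
`coreLift A Ξ` of toolkit 2/4 — determined by free over-data `A_ν : λ⊞_{v,ν} ⋙ (𝒩⊞_v → ℰ•) ≅ proj`, `Ξ : log ⋙ proj ≅ proj` —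
this file proves that the two AGREE on every generator pair of Cor 5.5 (iii) (`coreLift_lgen_pre`, `coreLift_lgen_post`,
`coreLift_lgen`) EXACTLY WHEN the `ι⊞_{v,ε}` lie over `Th•[Z]` w.r.t. the over-data, i.e. under the hypotheses

* pre-log `ε : ν₁ → ν₂`: `(𝒩⊞_v → ℰ•)(ι⊞_{v,ε,X}) = A_{ν₁,X} ∘ A_{ν₂,X}⁻¹`;
* post-log `ε`: `(𝒩⊞_v → ℰ•)(ι⊞_{v,ε,X}) = A_{sl,log X} ∘ Ξ_X ∘ A_{ν₂,X}⁻¹`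

(stated with `HEq`, the functor `Λ_ν` in the domain of `ι⊞_{v,ε}` being only propositionally `𝟭` / `log`).  Proof: the
uniqueness `coreLift_ext` of toolkit 2/4 (faithfulness of `T = κ_{An•} ⋙ κ₂`) against an explicit computation of the
structure isomorphisms `pathIso` along the paths `[λ⊞_ν]∘[forget]∘[toE]`, `[log]∘[id_⋎]∘[λ⊞_{sl}]∘[forget]∘[toE]`,
`[id_{⋎+1}]∘[λ⊞_{ν₂}]∘[forget]∘[toE]` (`pathIso_*_hom_app_heq`).  In print both hypotheses hold by Def 5.4 (iv)/(ii)
("`λ⊞_{v,ν}`, `log` lie over `Th•[Z]`", with `A := lamOver`, `Ξ := logOver` once the interface records the same for `ι⊞`).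

Pure bookkeeping over the interface; the two displayed conditions are HYPOTHESES; no claim of the paper is asserted.
Refereed pre-IUT material; nothing here bears on [IUTchIII] Cor. 3.12; typed ≠ proved.
-/

set_option autoImplicit false

universe u

open CategoryTheory Quiver

namespace Literature.AnabelianGeometry.AbsoluteAnabelian

/-! ## Bookkeeping -/

section HEqLemmas

/-- A functor maps heterogeneously equal morphisms (between pairwise equal objects) to heterogeneously equal
morphisms. [folklore] -/
private theorem Functor.map_heq_of_heq {C D : Type*} [Category C] [Category D] (F : C ⥤ D) {a a' b b' : C} (ha : a = a')
    (hb : b = b') {f : a ⟶ b} {g : a' ⟶ b'} (h : f ≍ g) : F.map f ≍ F.map g := by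
  subst ha hb
  cases h
  rfl

/-- Inverses of heterogeneously equal isomorphisms are heterogeneously equal. [folklore] -/
private theorem Iso.inv_heq_of_hom_heq {C : Type*} [Category C] {X Y X' Y' : C} (i : X ≅ Y) (i' : X' ≅ Y') (hX : X = X')
    (hY : Y = Y') (h : i.hom ≍ i'.hom) : i.inv ≍ i'.inv := by
  subst hX hY
  have : i = i' := Iso.ext (eq_of_heq h)
  subst this
  rfl

/-- Components of a natural transformation at equal objects are heterogeneously equal. [folklore] -/
private theorem NatTrans.app_heq' {C D : Type*} [Category C] [Category D] {F G : C ⥤ D} (α : F ⟶ G) {x y : C} (h : x = y) :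
    α.app x ≍ α.app y := by
  subst h
  rfl

/-- An `eqToHom` is heterogeneously an identity. [folklore] -/
private theorem eqToHom_heq_id_cod {C : Type*} [Category C] {X Y : C} (h : X = Y) : eqToHom h ≍ 𝟙 Y := by
  cases h
  rfl

end HEqLemmas

namespace LogFrobeniusSetting

variable {Vmod : Type u} {isArc : Vmod → Bool} (L : LogFrobeniusSetting Vmod isArc) (v : Vmod)

/-- The functor of a full sub-diagram of `D•⊢` at an arrow is the functor of `D•⊢` there (definitional).
[cite: MochizukiAbsTopIII2015, Cor 5.5 p. 130] -/
theorem subdiagram_map' (P : DVertex Vmod isArc → Prop) {a b : DSub P} (e : a ⟶ b) :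
    (L.subdiagram P).map e = DEdge.functor L e := rfl

/-- the tail `[toE] ∘ [forget] : 𝒩⊞_v → 𝒩_v → ℰ•` of `Γ⃗_{D•}`. [cite: MochizukiAbsTopIII2015, Cor 5.5 p. 130] -/
def ftP : Path (DVertex.nplus v : DVertex Vmod isArc) .e5 :=
  (Path.nil.cons (DEdge.forget v)).cons (DEdge.toE v)

/-- its path functor. [cite: MochizukiAbsTopIII2015, Definition 3.5 (i) p.75] -/
theorem pathFunctor_ftP : L.diagram.pathFunctor (ftP v) = (𝟭 _ ⋙ L.forget v) ⋙ L.toE v := by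
  simp only [ftP, DiagramOfCategories.pathFunctor_cons, DiagramOfCategories.pathFunctor_nil]
  rfl

/-- the path functor of `[λ⊞_ν]∘[forget]∘[toE]`. [cite: MochizukiAbsTopIII2015, Definition 3.5 (i) p.75] -/
theorem pathFunctor_lamP_comp_ftP (ν : LogVertex (isArc v)) (hν : ν.isPostLog = false) :
    L.diagram.pathFunctor ((lamP v ν hν).comp (ftP v)) =
      ((frobeniusTwist L.log ν.isPostLog ⋙ L.lam v ν) ⋙ L.forget v) ⋙ L.toE v := by
  rw [DiagramOfCategories.pathFunctor_comp, pathFunctor_ftP, pathFunctor_lamP]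
  rfl

/-- `ℰ•` (row 5) is a core vertex. [cite: MochizukiAbsTopIII2015, Cor 5.5 (i) p. 130] -/
theorem e5_isCoreVertex : IsCoreVertex (DVertex.e5 : DVertex Vmod isArc) := trivial

/-- `ℰ•` (row 5) is holomorphic. [cite: MochizukiAbsTopIII2015, Cor 5.5 p. 130] -/
theorem e5_isHolomorphic : (DVertex.e5 : DVertex Vmod isArc).IsHolomorphic := trivial

/-- For a pre-log vertex `Λ_ν = 𝟭` (Def 5.4 (vii)), on objects seen in `ℰ•`. [cite: MochizukiAbsTopIII2015, Def 5.4 (vii) p. 128] -/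
theorem toE_forget_twist_obj {ν : LogVertex (isArc v)} (hν : ν.isPostLog = false) (X₀ : L.X) :
    (L.toE v).obj ((L.forget v).obj ((L.lam v ν).obj ((frobeniusTwist L.log ν.isPostLog).obj X₀))) =
      (L.toE v).obj ((L.forget v).obj ((L.lam v ν).obj X₀)) := by
  rw [hν]
  rfl

/-- objects along `[λ⊞_ν]∘[forget]∘[toE]`. [cite: MochizukiAbsTopIII2015, Definition 3.5 (i) p.75] -/
theorem pathFunctor_lamP_comp_ftP_obj (ν : LogVertex (isArc v)) (hν : ν.isPostLog = false) (x : L.X) :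
    (L.diagram.pathFunctor ((lamP v ν hν).comp (ftP v))).obj x = (L.toE v).obj ((L.forget v).obj ((L.lam v ν).obj x)) :=
  (Functor.congr_obj (L.pathFunctor_lamP_comp_ftP v ν hν) x).trans (L.toE_forget_twist_obj v hν x)

variable (A : ∀ (v : Vmod) (ν : LogVertex (isArc v)), ν.isPostLog = false → (L.lam v ν ⋙ L.forget v ⋙ L.toE v ≅ L.proj))
  (Ξ : L.log ⋙ L.proj ≅ L.proj)

/-- The structure isomorphism along `[λ⊞_ν]∘[forget]∘[toE]` is `T(A_ν)`, componentwise (heterogeneously: the two sides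
live over definitionally, not syntactically, equal objects). [cite: MochizukiAbsTopIII2015, Remark 3.5.1 p.78] -/
theorem pathIso_lamP_ftP_hom_app_heq (ν : LogVertex (isArc v)) (hν : ν.isPostLog = false) (x : L.X) :
    ((L.holOverData A Ξ).pathIso (holLift ((lamP v ν hν).comp (ftP v)) e5_isHolomorphic)).hom.app x ≍
      (L.κAn.functor ⋙ L.κAn₂.functor).map ((A v ν hν).hom.app x) := by
  simp only [holLift, DSub.liftPath, lamP, ftP, Path.comp_cons, Path.comp_nil,
    DiagramOfCategories.OverData.pathIso_cons_app, DiagramOfCategories.OverData.pathIso_nil_app, holOverData, holμ,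
    Iso.refl_hom, Iso.trans_hom, Iso.symm_hom, NatTrans.comp_app, NatTrans.id_app, Functor.associator_inv_app,
    Functor.isoWhiskerRight_hom, Functor.whiskerRight_app, holN]
  have hy : ((L.subdiagram DVertex.IsHolomorphic).pathFunctor
      (Path.nil : Path (V := DSub (DVertex.IsHolomorphic (isArc := isArc))) ⟨.core, trivial⟩ ⟨.core, trivial⟩)).obj x =
      x :=
    Functor.congr_obj ((L.subdiagram DVertex.IsHolomorphic).pathFunctor_nil ⟨DVertex.core, trivial⟩) x
  refine (eqToHom_comp_heq _ _).trans ?_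
  refine (heq_of_eq (Category.id_comp _)).trans ?_
  refine (eqToHom_comp_heq _ _).trans ?_
  refine (heq_of_eq (Category.id_comp _)).trans ?_
  refine (eqToHom_comp_heq _ _).trans ?_
  refine (comp_eqToHom_heq _ _).trans ?_
  refine (heq_of_eq (Category.id_comp _)).trans ?_
  exact Functor.map_heq_of_heq _ (by rw [hy]) (by rw [hy]) (NatTrans.app_heq' (A v ν hν).hom hy)

/-- objects of the lifted path functor along `[λ⊞_ν]∘[forget]∘[toE]`, seen through the structure functor at `ℰ•`.
[cite: MochizukiAbsTopIII2015, Definition 3.5 (i) p.75] -/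
theorem holN_pathFunctor_holLift_lamP_ftP_obj (ν : LogVertex (isArc v)) (hν : ν.isPostLog = false) (x : L.X) :
    ((L.subdiagram DVertex.IsHolomorphic).pathFunctor (holLift ((lamP v ν hν).comp (ftP v)) e5_isHolomorphic) ⋙
        (L.holOverData A Ξ).N ⟨.e5, e5_isHolomorphic⟩).obj x =
      (L.κAn.functor ⋙ L.κAn₂.functor).obj ((L.toE v).obj ((L.forget v).obj ((L.lam v ν).obj x))) := by
  show (L.holN .e5 e5_isHolomorphic).obj (((L.subdiagram DVertex.IsHolomorphic).pathFunctor
    (holLift ((lamP v ν hν).comp (ftP v)) e5_isHolomorphic)).obj x) = _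
  rw [← L.pathFunctor_eq_holLift, L.pathFunctor_lamP_comp_ftP_obj v ν hν x]
  rfl

/-- **KEY (pre-log generators)**: on the whiskered generator pair `([λ⊞_{ν₁}]∘[forget]∘[toE], [λ⊞_{ν₂}]∘[forget]∘[toE])`
the core homotopy over `ℰ•` IS `ι⊞_{v,ε} ▷ (𝒩⊞_v → 𝒩_v → ℰ•)`, as soon as `ι⊞_{v,ε}` lies over `Th•[Z]` w.r.t. `A`.
[cite: MochizukiAbsTopIII2015, Cor 5.5 (iii) p. 131] -/
theorem coreLift_lgen_pre (ν₁ ν₂ : LogVertex (isArc v)) (ε : LogEdge (isArc v) ν₁ ν₂) (h₁ : ν₁.isPostLog = false)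
    (h₂ : ν₂.isPostLog = false)
    (hpre : ∀ X₀ : L.X, (L.toE v).map ((L.forget v).map ((L.iota v ε).app X₀)) ≍
      ((A v ν₁ h₁).hom.app X₀ ≫ (A v ν₂ h₂).inv.app X₀)) :
    L.coreLift A Ξ e5_isCoreVertex ((lamP v ν₁ h₁).comp (ftP v)) ((lamP v ν₂ h₂).comp (ftP v)) =
      eqToHom (L.diagram.pathFunctor_comp _ _) ≫
        Functor.whiskerRight (L.lgenHom v (LGen.pre ν₁ ν₂ ε h₁ h₂)) (L.diagram.pathFunctor (ftP v)) ≫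
        eqToHom (L.diagram.pathFunctor_comp _ _).symm := by
  refine (L.coreLift_ext A Ξ e5_isCoreVertex _ fun x => ?_).symm
  have hlgen : (L.lgenHom v (LGen.pre ν₁ ν₂ ε h₁ h₂)).app x ≍ (L.iota v ε).app x := by
    unfold lgenHom
    simp only [NatTrans.comp_app, eqToHom_app]
    exact (eqToHom_comp_heq _ _).trans (comp_eqToHom_heq _ _)
  -- the left-hand side: `ι⊞ ▷ (𝒩⊞_v → ℰ•)` over `ℰ•`
  have hA : (L.holN .e5 (isHolomorphic_of_isCoreVertex e5_isCoreVertex)).map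
      ((eqToHom (L.diagram.pathFunctor_comp _ _) ≫
        Functor.whiskerRight (L.lgenHom v (LGen.pre ν₁ ν₂ ε h₁ h₂)) (L.diagram.pathFunctor (ftP v)) ≫
        eqToHom (L.diagram.pathFunctor_comp ((lamP v ν₂ h₂)) (ftP v)).symm).app x) ≍
      (L.κAn.functor ⋙ L.κAn₂.functor).map ((A v ν₁ h₁).hom.app x ≫ (A v ν₂ h₂).inv.app x) := by
    simp only [NatTrans.comp_app, eqToHom_app, Functor.whiskerRight_app]
    refine Functor.map_heq_of_heq _ (L.pathFunctor_lamP_comp_ftP_obj v ν₁ h₁ x)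
      (L.pathFunctor_lamP_comp_ftP_obj v ν₂ h₂ x) ?_
    refine (eqToHom_comp_heq _ _).trans ((comp_eqToHom_heq _ _).trans ?_)
    refine (Functor.hcongr_hom (L.pathFunctor_ftP v) _).trans (HEq.trans ?_ (hpre x))
    exact Functor.map_heq_of_heq (L.forget v ⋙ L.toE v) (Functor.congr_obj (L.pathFunctor_lamP v ν₁ h₁) x)
      (Functor.congr_obj (L.pathFunctor_lamP' v ν₂ h₂) x).symm hlgen
  -- the right-hand side: `pathIso ∘ pathIso⁻¹`
  have hB : ((L.holOverData A Ξ).pathIso (holLift ((lamP v ν₁ h₁).comp (ftP v))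
        (isHolomorphic_of_isCoreVertex e5_isCoreVertex))).hom.app x ≫
      ((L.holOverData A Ξ).pathIso (holLift ((lamP v ν₂ h₂).comp (ftP v))
        (isHolomorphic_of_isCoreVertex e5_isCoreVertex))).inv.app x ≍
      (L.κAn.functor ⋙ L.κAn₂.functor).map ((A v ν₁ h₁).hom.app x ≫ (A v ν₂ h₂).inv.app x) := by
    rw [Functor.map_comp]
    refine heq_comp (L.holN_pathFunctor_holLift_lamP_ftP_obj v A Ξ ν₁ h₁ x) rfl
      (L.holN_pathFunctor_holLift_lamP_ftP_obj v A Ξ ν₂ h₂ x) (L.pathIso_lamP_ftP_hom_app_heq v A Ξ ν₁ h₁ x) ?_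
    exact Iso.inv_heq_of_hom_heq (((L.holOverData A Ξ).pathIso (holLift ((lamP v ν₂ h₂).comp (ftP v))
        e5_isHolomorphic)).app x) ((L.κAn.functor ⋙ L.κAn₂.functor).mapIso ((A v ν₂ h₂).app x))
      (L.holN_pathFunctor_holLift_lamP_ftP_obj v A Ξ ν₂ h₂ x) rfl (L.pathIso_lamP_ftP_hom_app_heq v A Ξ ν₂ h₂ x)
  exact hA.trans hB.symm

/-! ## The post-log generators -/

/-- objects along `[log]∘[id_⋎]∘[λ⊞_{sl}]∘[forget]∘[toE]`. [cite: MochizukiAbsTopIII2015, Definition 3.5 (i) p.75] -/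
theorem pathFunctor_postDomP_comp_ftP_obj (n : ℤ) (hsl : (LogVertex.spaceLink (isArc v)).isPostLog = false) (x : L.X) :
    (L.diagram.pathFunctor ((postDomP v n hsl).comp (ftP v))).obj x =
      (L.toE v).obj ((L.forget v).obj ((L.lam v (LogVertex.spaceLink (isArc v))).obj (L.log.obj x))) := by
  rw [DiagramOfCategories.pathFunctor_comp, pathFunctor_ftP, postDomP, DiagramOfCategories.pathFunctor_cons,
    DiagramOfCategories.pathFunctor_cons, DiagramOfCategories.pathFunctor_cons, DiagramOfCategories.pathFunctor_nil]
  rfl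

/-- objects along `[id_{⋎+1}]∘[λ⊞_{ν₂}]∘[forget]∘[toE]`. [cite: MochizukiAbsTopIII2015, Definition 3.5 (i) p.75] -/
theorem pathFunctor_postCodP_comp_ftP_obj (n : ℤ) (ν₂ : LogVertex (isArc v)) (h₂ : ν₂.isPostLog = false) (x : L.X) :
    (L.diagram.pathFunctor ((postCodP v n ν₂ h₂).comp (ftP v))).obj x =
      (L.toE v).obj ((L.forget v).obj ((L.lam v ν₂).obj x)) := by
  rw [DiagramOfCategories.pathFunctor_comp, pathFunctor_ftP, postCodP, DiagramOfCategories.pathFunctor_cons,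
    DiagramOfCategories.pathFunctor_cons, DiagramOfCategories.pathFunctor_nil]
  rfl

/-- The structure isomorphism along `[log]∘[id_⋎]∘[λ⊞_sl]∘[forget]∘[toE]` is `T(A_sl(log x)) ∘ T(Ξ_x)`, componentwise
(heterogeneously). [cite: MochizukiAbsTopIII2015, Remark 3.5.1 p.78] -/
theorem pathIso_postDomP_ftP_hom_app_heq (n : ℤ) (hsl : (LogVertex.spaceLink (isArc v)).isPostLog = false) (x : L.X) :
    ((L.holOverData A Ξ).pathIso (holLift ((postDomP v n hsl).comp (ftP v)) e5_isHolomorphic)).hom.app x ≍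
      (L.κAn.functor ⋙ L.κAn₂.functor).map ((A v _ hsl).hom.app (L.log.obj x)) ≫
        (L.κAn.functor ⋙ L.κAn₂.functor).map (Ξ.hom.app x) := by
  simp only [holLift, DSub.liftPath, postDomP, ftP, Path.comp_cons, Path.comp_nil,
    DiagramOfCategories.OverData.pathIso_cons_app, DiagramOfCategories.OverData.pathIso_nil_app, holOverData, holμ,
    Iso.refl_hom, Iso.trans_hom, Iso.symm_hom, NatTrans.comp_app, NatTrans.id_app, Functor.associator_inv_app,
    Functor.isoWhiskerRight_hom, Functor.whiskerRight_app, Functor.leftUnitor_hom_app, holN]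
  have hy₃ : ((L.subdiagram DVertex.IsHolomorphic).pathFunctor (DSub.liftPath DVertex.isHolomorphic_of_hom
      ((Path.nil.cons (DEdge.log n)).cons (DEdge.toCore n) : Path (DVertex.row1 (n + 1) : DVertex Vmod isArc) .core)
      trivial)).obj x = L.log.obj x := by
    refine (Functor.congr_obj (L.pathFunctor_liftPath DVertex.isHolomorphic_of_hom
      ((Path.nil.cons (DEdge.log n)).cons (DEdge.toCore n) : Path (DVertex.row1 (n + 1) : DVertex Vmod isArc) .core)
      trivial) x).trans ?_
    simp only [DiagramOfCategories.pathFunctor_cons, DiagramOfCategories.pathFunctor_nil, Functor.comp_obj,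
      Functor.id_obj]
    rfl
  have hy₅ : ((L.subdiagram DVertex.IsHolomorphic).pathFunctor
      (Path.nil : Path (V := DSub (DVertex.IsHolomorphic (isArc := isArc))) ⟨.row1 (n + 1), trivial⟩
        ⟨.row1 (n + 1), trivial⟩)).obj x = x :=
    Functor.congr_obj ((L.subdiagram DVertex.IsHolomorphic).pathFunctor_nil ⟨DVertex.row1 (n + 1), trivial⟩) x
  refine (eqToHom_comp_heq _ _).trans ?_
  refine (heq_of_eq (Category.id_comp _)).trans ?_
  refine (eqToHom_comp_heq _ _).trans ?_
  refine (heq_of_eq (Category.id_comp _)).trans ?_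
  refine (eqToHom_comp_heq _ _).trans ?_
  refine heq_comp ?_ ?_ rfl ?_ ?_
  · exact congrArg (fun z => (L.κAn.functor ⋙ L.κAn₂.functor).obj ((L.toE v).obj ((L.forget v).obj
      ((L.lam v (LogVertex.spaceLink (isArc v))).obj z)))) hy₃
  · exact congrArg (fun z => (L.κAn.functor ⋙ L.κAn₂.functor).obj (L.proj.obj z)) hy₃
  · refine (heq_of_eq (Category.id_comp _)).trans ?_
    exact Functor.map_heq_of_heq _
      (congrArg (fun z => (L.lam v (LogVertex.spaceLink (isArc v)) ⋙ L.forget v ⋙ L.toE v).obj z) hy₃)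
      (congrArg (fun z => L.proj.obj z) hy₃) (NatTrans.app_heq' (A v _ hsl).hom hy₃)
  · refine (eqToHom_comp_heq _ _).trans ?_
    refine (heq_of_eq (Category.id_comp _)).trans ?_
    refine (eqToHom_comp_heq _ _).trans ?_
    refine (comp_eqToHom_heq _ _).trans ?_
    refine (heq_of_eq (Category.id_comp _)).trans ?_
    exact Functor.map_heq_of_heq _ (congrArg (fun z => (L.log ⋙ L.proj).obj z) hy₅)
      (congrArg (fun z => L.proj.obj z) hy₅) (NatTrans.app_heq' Ξ.hom hy₅)

/-- The structure isomorphism along `[id_{⋎+1}]∘[λ⊞_{ν₂}]∘[forget]∘[toE]` is `T(A_{ν₂})`, componentwise (heterogeneously).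
[cite: MochizukiAbsTopIII2015, Remark 3.5.1 p.78] -/
theorem pathIso_postCodP_ftP_hom_app_heq (n : ℤ) (ν₂ : LogVertex (isArc v)) (h₂ : ν₂.isPostLog = false) (x : L.X) :
    ((L.holOverData A Ξ).pathIso (holLift ((postCodP v n ν₂ h₂).comp (ftP v)) e5_isHolomorphic)).hom.app x ≍
      (L.κAn.functor ⋙ L.κAn₂.functor).map ((A v ν₂ h₂).hom.app x) := by
  simp only [holLift, DSub.liftPath, postCodP, ftP, Path.comp_cons, Path.comp_nil,
    DiagramOfCategories.OverData.pathIso_cons_app, DiagramOfCategories.OverData.pathIso_nil_app, holOverData, holμ,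
    Iso.refl_hom, Iso.trans_hom, Iso.symm_hom, NatTrans.comp_app, NatTrans.id_app, Functor.associator_inv_app,
    Functor.isoWhiskerRight_hom, Functor.whiskerRight_app, Functor.leftUnitor_hom_app, holN]
  have hy : ((L.subdiagram DVertex.IsHolomorphic).pathFunctor (DSub.liftPath DVertex.isHolomorphic_of_hom
      (Path.nil.cons (DEdge.toCore (n + 1)) : Path (DVertex.row1 (n + 1) : DVertex Vmod isArc) .core)
      trivial)).obj x = x := by
    refine (Functor.congr_obj (L.pathFunctor_liftPath DVertex.isHolomorphic_of_hom
      (Path.nil.cons (DEdge.toCore (n + 1)) : Path (DVertex.row1 (n + 1) : DVertex Vmod isArc) .core)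
      trivial) x).trans ?_
    simp only [DiagramOfCategories.pathFunctor_cons, DiagramOfCategories.pathFunctor_nil, Functor.comp_obj,
      Functor.id_obj]
    rfl
  refine (eqToHom_comp_heq _ _).trans ?_
  refine (heq_of_eq (Category.id_comp _)).trans ?_
  refine (eqToHom_comp_heq _ _).trans ?_
  refine (heq_of_eq (Category.id_comp _)).trans ?_
  refine (eqToHom_comp_heq _ _).trans ?_
  refine HEq.trans ?_ (heq_of_eq (Category.comp_id _))
  refine heq_comp ?_ ?_ rfl ?_ ?_
  · exact congrArg (fun z => (L.κAn.functor ⋙ L.κAn₂.functor).obj ((L.toE v).obj ((L.forget v).obj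
      ((L.lam v ν₂).obj z)))) hy
  · exact congrArg (fun z => (L.κAn.functor ⋙ L.κAn₂.functor).obj (L.proj.obj z)) hy
  · refine (heq_of_eq (Category.id_comp _)).trans ?_
    exact Functor.map_heq_of_heq _ (congrArg (fun z => (L.lam v ν₂ ⋙ L.forget v ⋙ L.toE v).obj z) hy)
      (congrArg (fun z => L.proj.obj z) hy) (NatTrans.app_heq' (A v ν₂ h₂).hom hy)
  · refine (eqToHom_comp_heq _ _).trans ?_
    refine (heq_of_eq (Category.id_comp _)).trans ?_
    exact eqToHom_heq_id_cod _

/-- objects of the lifted path functor along the post-log domain path, through the structure functor at `ℰ•`.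
[cite: MochizukiAbsTopIII2015, Definition 3.5 (i) p.75] -/
theorem holN_pathFunctor_holLift_postDomP_ftP_obj (n : ℤ) (hsl : (LogVertex.spaceLink (isArc v)).isPostLog = false)
    (x : L.X) :
    ((L.subdiagram DVertex.IsHolomorphic).pathFunctor (holLift ((postDomP v n hsl).comp (ftP v)) e5_isHolomorphic) ⋙
        (L.holOverData A Ξ).N ⟨.e5, e5_isHolomorphic⟩).obj x =
      (L.κAn.functor ⋙ L.κAn₂.functor).obj
        ((L.toE v).obj ((L.forget v).obj ((L.lam v (LogVertex.spaceLink (isArc v))).obj (L.log.obj x)))) := by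
  show (L.holN .e5 e5_isHolomorphic).obj (((L.subdiagram DVertex.IsHolomorphic).pathFunctor
    (holLift ((postDomP v n hsl).comp (ftP v)) e5_isHolomorphic)).obj x) = _
  rw [← L.pathFunctor_eq_holLift, L.pathFunctor_postDomP_comp_ftP_obj v n hsl x]
  rfl

/-- objects of the lifted path functor along the post-log codomain path, through the structure functor at `ℰ•`.
[cite: MochizukiAbsTopIII2015, Definition 3.5 (i) p.75] -/
theorem holN_pathFunctor_holLift_postCodP_ftP_obj (n : ℤ) (ν₂ : LogVertex (isArc v)) (h₂ : ν₂.isPostLog = false)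
    (x : L.X) :
    ((L.subdiagram DVertex.IsHolomorphic).pathFunctor (holLift ((postCodP v n ν₂ h₂).comp (ftP v)) e5_isHolomorphic) ⋙
        (L.holOverData A Ξ).N ⟨.e5, e5_isHolomorphic⟩).obj x =
      (L.κAn.functor ⋙ L.κAn₂.functor).obj ((L.toE v).obj ((L.forget v).obj ((L.lam v ν₂).obj x))) := by
  show (L.holN .e5 e5_isHolomorphic).obj (((L.subdiagram DVertex.IsHolomorphic).pathFunctor
    (holLift ((postCodP v n ν₂ h₂).comp (ftP v)) e5_isHolomorphic)).obj x) = _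
  rw [← L.pathFunctor_eq_holLift, L.pathFunctor_postCodP_comp_ftP_obj v n ν₂ h₂ x]
  rfl

/-- **KEY (post-log generators)**: on the whiskered generator pair
`([log]∘[id_⋎]∘[λ⊞_{sl}]∘[forget]∘[toE], [id_{⋎+1}]∘[λ⊞_{ν₂}]∘[forget]∘[toE])` the core homotopy over `ℰ•` IS
`ι⊞_{v,ε} ▷ (𝒩⊞_v → 𝒩_v → ℰ•)`, as soon as `ι⊞_{v,ε}` lies over `Th•[Z]` w.r.t. `A` and `Ξ`.
[cite: MochizukiAbsTopIII2015, Cor 5.5 (iii) p. 131] -/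
theorem coreLift_lgen_post (ν₁ ν₂ : LogVertex (isArc v)) (ε : LogEdge (isArc v) ν₁ ν₂) (h₁ : ν₁.isPostLog = true)
    (h₂ : ν₂.isPostLog = false) (hsl : (LogVertex.spaceLink (isArc v)).isPostLog = false) (n : ℤ)
    (hpost : ∀ X₀ : L.X, (L.toE v).map ((L.forget v).map ((L.iota v ε).app X₀)) ≍
      ((A v _ hsl).hom.app (L.log.obj X₀) ≫ Ξ.hom.app X₀ ≫ (A v ν₂ h₂).inv.app X₀)) :
    L.coreLift A Ξ e5_isCoreVertex ((postDomP v n hsl).comp (ftP v)) ((postCodP v n ν₂ h₂).comp (ftP v)) =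
      eqToHom (L.diagram.pathFunctor_comp _ _) ≫
        Functor.whiskerRight (L.lgenHom v (LGen.post ν₁ ν₂ ε h₁ h₂ hsl n)) (L.diagram.pathFunctor (ftP v)) ≫
        eqToHom (L.diagram.pathFunctor_comp _ _).symm := by
  refine (L.coreLift_ext A Ξ e5_isCoreVertex _ fun x => ?_).symm
  have hlgen : (L.lgenHom v (LGen.post ν₁ ν₂ ε h₁ h₂ hsl n)).app x ≍ (L.iota v ε).app x := by
    unfold lgenHom
    simp only [NatTrans.comp_app, eqToHom_app]
    exact (eqToHom_comp_heq _ _).trans (comp_eqToHom_heq _ _)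
  have hA : (L.holN .e5 (isHolomorphic_of_isCoreVertex e5_isCoreVertex)).map
      ((eqToHom (L.diagram.pathFunctor_comp _ _) ≫
        Functor.whiskerRight (L.lgenHom v (LGen.post ν₁ ν₂ ε h₁ h₂ hsl n)) (L.diagram.pathFunctor (ftP v)) ≫
        eqToHom (L.diagram.pathFunctor_comp ((postCodP v n ν₂ h₂)) (ftP v)).symm).app x) ≍
      (L.κAn.functor ⋙ L.κAn₂.functor).map
        ((A v _ hsl).hom.app (L.log.obj x) ≫ Ξ.hom.app x ≫ (A v ν₂ h₂).inv.app x) := by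
    simp only [NatTrans.comp_app, eqToHom_app, Functor.whiskerRight_app]
    refine Functor.map_heq_of_heq _ (L.pathFunctor_postDomP_comp_ftP_obj v n hsl x)
      (L.pathFunctor_postCodP_comp_ftP_obj v n ν₂ h₂ x) ?_
    refine (eqToHom_comp_heq _ _).trans ((comp_eqToHom_heq _ _).trans ?_)
    refine (Functor.hcongr_hom (L.pathFunctor_ftP v) _).trans (HEq.trans ?_ (hpost x))
    exact Functor.map_heq_of_heq (L.forget v ⋙ L.toE v) (Functor.congr_obj (L.pathFunctor_postDomP v ν₁ h₁ n hsl) x)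
      (Functor.congr_obj (L.pathFunctor_postCodP v n ν₂ h₂) x).symm hlgen
  have hB : ((L.holOverData A Ξ).pathIso (holLift ((postDomP v n hsl).comp (ftP v))
        (isHolomorphic_of_isCoreVertex e5_isCoreVertex))).hom.app x ≫
      ((L.holOverData A Ξ).pathIso (holLift ((postCodP v n ν₂ h₂).comp (ftP v))
        (isHolomorphic_of_isCoreVertex e5_isCoreVertex))).inv.app x ≍
      ((L.κAn.functor ⋙ L.κAn₂.functor).map ((A v _ hsl).hom.app (L.log.obj x)) ≫
        (L.κAn.functor ⋙ L.κAn₂.functor).map (Ξ.hom.app x)) ≫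
        (L.κAn.functor ⋙ L.κAn₂.functor).map ((A v ν₂ h₂).inv.app x) := by
    refine heq_comp (L.holN_pathFunctor_holLift_postDomP_ftP_obj v A Ξ n hsl x) rfl
      (L.holN_pathFunctor_holLift_postCodP_ftP_obj v A Ξ n ν₂ h₂ x) (L.pathIso_postDomP_ftP_hom_app_heq v A Ξ n hsl x) ?_
    exact Iso.inv_heq_of_hom_heq (((L.holOverData A Ξ).pathIso (holLift ((postCodP v n ν₂ h₂).comp (ftP v))
        e5_isHolomorphic)).app x) ((L.κAn.functor ⋙ L.κAn₂.functor).mapIso ((A v ν₂ h₂).app x))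
      (L.holN_pathFunctor_holLift_postCodP_ftP_obj v A Ξ n ν₂ h₂ x) rfl
      (L.pathIso_postCodP_ftP_hom_app_heq v A Ξ n ν₂ h₂ x)
  have hE : ((L.κAn.functor ⋙ L.κAn₂.functor).map ((A v _ hsl).hom.app (L.log.obj x)) ≫
        (L.κAn.functor ⋙ L.κAn₂.functor).map (Ξ.hom.app x)) ≫
        (L.κAn.functor ⋙ L.κAn₂.functor).map ((A v ν₂ h₂).inv.app x) =
      (L.κAn.functor ⋙ L.κAn₂.functor).map
        ((A v _ hsl).hom.app (L.log.obj x) ≫ Ξ.hom.app x ≫ (A v ν₂ h₂).inv.app x) := by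
    simp only [Functor.map_comp, Category.assoc]
  exact hA.trans ((hB.trans (heq_of_eq hE)).symm)

/-- **KEY, both kinds of generators at once**: for every generator pair `(g, g')` of Cor 5.5 (iii) at `v` (`LGen`), the core
homotopy over `ℰ•` of toolkit 2/4 on the whiskered pair `(g∘[forget]∘[toE], g'∘[forget]∘[toE])` is the whiskered generator
homotopy `ι⊞ ▷ (𝒩⊞_v → ℰ•)` — provided the `ι⊞_{v,ε}` lie over `Th•[Z]` w.r.t. `A`, `Ξ` (both hypotheses).
[cite: MochizukiAbsTopIII2015, Cor 5.5 (iii) p. 131] -/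
theorem coreLift_lgen
    (hpre : ∀ (ν₁ ν₂ : LogVertex (isArc v)) (ε : LogEdge (isArc v) ν₁ ν₂) (h₁ : ν₁.isPostLog = false)
      (h₂ : ν₂.isPostLog = false) (X₀ : L.X), (L.toE v).map ((L.forget v).map ((L.iota v ε).app X₀)) ≍
      ((A v ν₁ h₁).hom.app X₀ ≫ (A v ν₂ h₂).inv.app X₀))
    (hpost : ∀ (ν₁ ν₂ : LogVertex (isArc v)) (ε : LogEdge (isArc v) ν₁ ν₂) (_ : ν₁.isPostLog = true)
      (h₂ : ν₂.isPostLog = false) (hsl : (LogVertex.spaceLink (isArc v)).isPostLog = false) (X₀ : L.X),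
      (L.toE v).map ((L.forget v).map ((L.iota v ε).app X₀)) ≍
      ((A v _ hsl).hom.app (L.log.obj X₀) ≫ Ξ.hom.app X₀ ≫ (A v ν₂ h₂).inv.app X₀))
    {c : DVertex Vmod isArc} {g g' : Path c (DVertex.nplus v)} (s : LGen (isArc := isArc) v g g') :
    L.coreLift A Ξ e5_isCoreVertex (g.comp (ftP v)) (g'.comp (ftP v)) =
      eqToHom (L.diagram.pathFunctor_comp _ _) ≫
        Functor.whiskerRight (L.lgenHom v s) (L.diagram.pathFunctor (ftP v)) ≫
        eqToHom (L.diagram.pathFunctor_comp _ _).symm := by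
  cases s with
  | pre ν₁ ν₂ ε h₁ h₂ => exact L.coreLift_lgen_pre v A Ξ ν₁ ν₂ ε h₁ h₂ (hpre ν₁ ν₂ ε h₁ h₂)
  | post ν₁ ν₂ ε h₁ h₂ hsl n => exact L.coreLift_lgen_post v A Ξ ν₁ ν₂ ε h₁ h₂ hsl n (hpost ν₁ ν₂ ε h₁ h₂ hsl)

end LogFrobeniusSetting

end Literature.AnabelianGeometry.AbsoluteAnabelian
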